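import Summits.BirchSwinnertonDyer.Rank1Residual.P2.KrizLiTwistMinimalModelsGoodBases
import Summits.BirchSwinnertonDyer.Rank1Residual.P2.KrizLiTwistMinimalModelsAdditiveBases
import Summits.BirchSwinnertonDyer.Rank1Residual.P2.KrizLiJZeroExplicitMembers
import Summits.BirchSwinnertonDyer.Rank1Residual.P2.KrizLiMordellExplicitMembers
import Summits.BirchSwinnertonDyer.Rank1Residual.P2.KrizLiCubeSumThirteenMembership
import Mathlib.Tactic.NormNum.LegendreSymbol
import HarnessLib

/-!
# Cell `bsd-print-cf2` (D-0131 (2) PRINT TIER, leaf CornerF @ `p = 2`), typer ty2 — EXPLICIT MEMBERS ON THE NOSE: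
# one minimal twist model per (★)-certified `j = 0` base, `ord_{s=1} L = 1 ∧ BSD(·, 2)` BY NAME for the CURVE
# ITSELF (`y² + y = x³ + 136245345 = 1323a1^{(61)}`, …, `y² = x³ + 105456 = 3888s1^{(13)}`)

HONEST FRAMING (cell `bsd-print-cf2`, run/shared/lean/pub/bsd-print-cf2/; verbatim): PARTITION currency only
— the leaf `Summit.BirchSwinnertonDyer.WAllCornerFTwo` counts when its class theorem is in the kernel BY NAME;
every imported theorem carries its printed hypotheses verbatim. The leaf and crux `InertJZeroOfFacts`
(stmt-BirchSwinnertonDyer-20671) are OPEN AS CLASSES; nothing class-wide is closed; THEOREMS ONLY — no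
definition, no named fact; Assumption (★) enters only as the displayed binder `hSD : P2.HasKrizLiStarDatum E K`
— a CERTIFICATE at these eight bases (lit dossier §14.4/§14.8), NOT print.

End-to-end check of the discharge interface `P2/KrizLiTwistMinimalModels{,GoodBases,AdditiveBases}.lean`
(p572967, p573804, p573893) at ONE explicit twist per base — the smallest admissible `d` of ty2 g3's / p3's
explicit-member files (`61 ∈ 𝒩(1323a1, ℚ(√−47))`, `61 ∈ 𝒩(1323m1, ℚ(√−47))`, `193 ∈ 𝒩(4563a1, ℚ(√−23))`,
`4681 = 31·151` for `(4563b1, ℚ(√−23))`, `13 ∈ 𝒩(E, ℚ(√−23))` for `E = 972d1, 1728a1, 1728v1, 3888s1`; all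
decided in the kernel there): where those files conclude on "every globally minimal `W'` `ℚ`-isogenous to
`E^{(d)}`", this file names THE CURVE — the globally minimal model of `E^{(d)}` with its integer coefficients —
and states `ord_{s=1} L = 1 ∧ BSD(·, 2)` for it, granted BY NAME the seven facts `hKL h33 hS31 hBF hmod hGZK
hCassels` and the displayed (★)-datum of the pair. The eight curves (rank-one members of the leaf `CornerF @ 2`,
INERT type; the first four GOOD at `2`, the last four ADDITIVE at `2`):
`y² + y = x³ + 136245345` (`1323a1^{(61)}`, `4k + 1 = 7⁴·61³`), `y² + y = x³ − 397217` (`1323m1^{(61)}`),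
`y² + y = x³ + 667311635175` (`4563a1^{(193)}`), `y² + y = x³ + 4333538274432` (`4563b1^{(4681)}`),
`y² = x³ + 79092` (`972d1^{(13)}`), `y² = x³ + 4394` (`1728a1^{(13)}`), `y² = x³ − 4394` (`1728v1^{(13)}`),
`y² = x³ + 105456` (`3888s1^{(13)}`, globally minimal by KRAUS at `2`: `Δ = −2¹²·3⁵·13⁶`, `c₄ = 0`). This is
the shape of a ty3 Kriz–Li certificate record's conclusion at these bases. Currency
LITERAL-by-name((★)-display); beyond-print theorem: NO.

References: [KrizLi2019] Thm 5.1 (2) = arXiv:1606.03172 Thm 1.12, Def 4.1, Thm 4.3, §6 Ex. 6.2;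
[CreutzMiller2012] Thm 1.1; [BurungaleFlach2024] Thm 1.1, Cor. 2; [MilneADT2006] Thm I.7.3; [SilvermanAEC2009]
VII.1 Remark 1.1; [Kraus1989] Prop. 2; [Cremona1997] Table 1; cell dossier §14.4/§14.8 (certified pairs); tree
`P2/KrizLi{JZero,Mordell}ExplicitMembers` (ty2 g3), `P2/KrizLiCubeSumThirteenMembership` (p3).
-/

noncomputable section

open scoped Classical

open WeierstrassCurve NumberField Literature.NumberTheory.EllipticCurves
  Literature.NumberTheory.EllipticCurves.Rank1Residual Literature.NumberTheory.EllipticCurves.ModularForms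
  Literature.NumberTheory.EllipticCurves.Rank1Residual.X11RankOneCertificates
  Summit.BirchSwinnertonDyer.Rank1Residual

set_option autoImplicit false

namespace Summit.BirchSwinnertonDyer.Rank1Residual.P2

/-! ## The four bases good at `2` -/

/-- **`y² + y = x³ + 136245345 = 1323a1^{(61)}`**: globally minimal, `ord_{s=1} L = 1 ∧ BSD(·, 2)` BY NAME (seven
facts + the displayed (★)-datum of `(1323a1, ℚ(√−47))`; `61 ∈ 𝒩` decided in the kernel).
[cite: KrizLi2019, Thm. 5.1 (2), Thm. 4.3, Def. 4.1, §6 Ex. 6.2] [cite: CreutzMiller2012, Thm. 1.1]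
[cite: BurungaleFlach2024, Thm. 1.1 and Cor. 2] [cite: MilneADT2006, Thm. I.7.3] -/
theorem analyticRank_eq_one_and_bsdp_two_twistModel_sixtyOne_curve1323a1 (hKL : KrizLi2019.thm112_bsdTwo_twist)
    (h33 : KrizLi2019.thm33_rank_twist) (hS31 : bsdTriple_of_analyticRank_le_one_of_conductor_lt)
    (hBF : bsdTriple_of_hasCM_of_L_one_ne_zero) (hmod : hasEntireLFunction_rat)
    (hGZK : rank_eq_analyticRank_of_analyticRank_le_one) (hCassels : bsdRHS_eq_of_isIsogenous)
    (hSD : HasKrizLiStarDatum curve1323a1 (sqrtField (-47))) :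
    ∃ _ : (cubicA₃ 136245345).IsGloballyMinimal,
      (cubicA₃ 136245345).analyticRank = 1 ∧ BSDp (cubicA₃ 136245345) 2 :=
  analyticRank_eq_one_and_bsdp_two_twistModel_curve1323a1 hKL h33 hS31 hBF hmod hGZK hCassels
    isImaginaryQuadratic_and_discr_sqrtField_neg_fortySeven.1
    (by rw [isImaginaryQuadratic_and_discr_sqrtField_neg_fortySeven.2]; norm_num)
    (by rw [isImaginaryQuadratic_and_discr_sqrtField_neg_fortySeven.2]; norm_num)
    hSD (d := 61) (by norm_num) inN_sixtyOne_curve1323a1 (by norm_num) (by norm_num) (by norm_num)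

/-- **`y² + y = x³ − 397217 = 1323m1^{(61)}`**: globally minimal, `ord_{s=1} L = 1 ∧ BSD(·, 2)` BY NAME (seven
facts + the displayed (★)-datum of `(1323m1, ℚ(√−47))`). [cite: KrizLi2019, Thm. 5.1 (2), Thm. 4.3, Def. 4.1, §6 Ex. 6.2]
[cite: CreutzMiller2012, Thm. 1.1] [cite: BurungaleFlach2024, Thm. 1.1 and Cor. 2] [cite: MilneADT2006, Thm. I.7.3] -/
theorem analyticRank_eq_one_and_bsdp_two_twistModel_sixtyOne_curve1323m1 (hKL : KrizLi2019.thm112_bsdTwo_twist)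
    (h33 : KrizLi2019.thm33_rank_twist) (hS31 : bsdTriple_of_analyticRank_le_one_of_conductor_lt)
    (hBF : bsdTriple_of_hasCM_of_L_one_ne_zero) (hmod : hasEntireLFunction_rat)
    (hGZK : rank_eq_analyticRank_of_analyticRank_le_one) (hCassels : bsdRHS_eq_of_isIsogenous)
    (hSD : HasKrizLiStarDatum curve1323m1 (sqrtField (-47))) :
    ∃ _ : (cubicA₃ (-397217)).IsGloballyMinimal,
      (cubicA₃ (-397217)).analyticRank = 1 ∧ BSDp (cubicA₃ (-397217)) 2 :=
  analyticRank_eq_one_and_bsdp_two_twistModel_curve1323m1 hKL h33 hS31 hBF hmod hGZK hCassels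
    isImaginaryQuadratic_and_discr_sqrtField_neg_fortySeven.1
    (by rw [isImaginaryQuadratic_and_discr_sqrtField_neg_fortySeven.2]; norm_num)
    (by rw [isImaginaryQuadratic_and_discr_sqrtField_neg_fortySeven.2]; norm_num)
    hSD (d := 61) (by norm_num) inN_sixtyOne_curve1323m1 (by norm_num) (by norm_num) (by norm_num)

/-- **`y² + y = x³ + 667311635175 = 4563a1^{(193)}`**: globally minimal, `ord_{s=1} L = 1 ∧ BSD(·, 2)` BY NAME
(seven facts + the displayed (★)-datum of `(4563a1, ℚ(√−23))`). [cite: KrizLi2019, Thm. 5.1 (2), Thm. 4.3, Def. 4.1, §6 Ex. 6.2]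
[cite: CreutzMiller2012, Thm. 1.1] [cite: BurungaleFlach2024, Thm. 1.1 and Cor. 2] [cite: MilneADT2006, Thm. I.7.3] -/
theorem analyticRank_eq_one_and_bsdp_two_twistModel_oneNinetyThree_curve4563a1
    (hKL : KrizLi2019.thm112_bsdTwo_twist) (h33 : KrizLi2019.thm33_rank_twist)
    (hS31 : bsdTriple_of_analyticRank_le_one_of_conductor_lt) (hBF : bsdTriple_of_hasCM_of_L_one_ne_zero)
    (hmod : hasEntireLFunction_rat) (hGZK : rank_eq_analyticRank_of_analyticRank_le_one)
    (hCassels : bsdRHS_eq_of_isIsogenous) (hSD : HasKrizLiStarDatum curve4563a1 (sqrtField (-23))) :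
    ∃ _ : (cubicA₃ 667311635175).IsGloballyMinimal,
      (cubicA₃ 667311635175).analyticRank = 1 ∧ BSDp (cubicA₃ 667311635175) 2 :=
  analyticRank_eq_one_and_bsdp_two_twistModel_curve4563a1 hKL h33 hS31 hBF hmod hGZK hCassels
    isImaginaryQuadratic_and_discr_sqrtField_neg_twentyThree.1
    (by rw [isImaginaryQuadratic_and_discr_sqrtField_neg_twentyThree.2]; norm_num)
    (by rw [isImaginaryQuadratic_and_discr_sqrtField_neg_twentyThree.2]; norm_num)
    hSD (d := 193) (by norm_num) inN_oneNinetyThree_curve4563a1 (by norm_num) (by norm_num) (by norm_num)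

/-- **`y² + y = x³ + 4333538274432 = 4563b1^{(4681)}`** (`4681 = 31·151`, the cube-sum class `x³ + y³ = 13`):
globally minimal, `ord_{s=1} L = 1 ∧ BSD(·, 2)` BY NAME (seven facts + the displayed (★)-datum of
`(4563b1, ℚ(√−23))`; `31, 151 ∈ 𝒮` by p3's `isKrizLiPrime4563_thirtyOne/_oneFiftyOne`).
[cite: KrizLi2019, Thm. 5.1 (2), Thm. 4.3, Def. 4.1] [cite: CreutzMiller2012, Thm. 1.1]
[cite: BurungaleFlach2024, Thm. 1.1 and Cor. 2] [cite: MilneADT2006, Thm. I.7.3] -/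
theorem analyticRank_eq_one_and_bsdp_two_twistModel_4681_curve4563b1 (hKL : KrizLi2019.thm112_bsdTwo_twist)
    (h33 : KrizLi2019.thm33_rank_twist) (hS31 : bsdTriple_of_analyticRank_le_one_of_conductor_lt)
    (hBF : bsdTriple_of_hasCM_of_L_one_ne_zero) (hmod : hasEntireLFunction_rat)
    (hGZK : rank_eq_analyticRank_of_analyticRank_le_one) (hCassels : bsdRHS_eq_of_isIsogenous)
    (hSD : HasKrizLiStarDatum curve4563b1 (sqrtField (-23))) :
    ∃ _ : (cubicA₃ 4333538274432).IsGloballyMinimal,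
      (cubicA₃ 4333538274432).analyticRank = 1 ∧ BSDp (cubicA₃ 4333538274432) 2 := by
  have hK := isImaginaryQuadratic_and_discr_sqrtField_neg_twentyThree
  have hsq : Squarefree (4681 : ℤ).natAbs := by
    have h : Squarefree (31 * 151) :=
      Nat.squarefree_mul_iff.2 ⟨by norm_num, (Nat.prime_iff.1 (by norm_num)).squarefree,
        (Nat.prime_iff.1 (by norm_num)).squarefree⟩
    simpa using h
  have hd : KrizLi2019.InN curve4563b1 (sqrtField (-23)) 4681 := by
    refine inN_curve4563b1 hK.1.1 hK.2 (by norm_num) hsq fun ℓ hℓ hℓd => ?_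
    have h : ℓ ∣ 31 * 151 := by simpa using hℓd
    rcases (Nat.Prime.dvd_mul hℓ).mp h with h | h
    · obtain rfl := (Nat.prime_dvd_prime_iff_eq hℓ (by norm_num)).mp h
      exact isKrizLiPrime4563_thirtyOne
    · obtain rfl := (Nat.prime_dvd_prime_iff_eq hℓ (by norm_num)).mp h
      exact isKrizLiPrime4563_oneFiftyOne
  exact analyticRank_eq_one_and_bsdp_two_twistModel_curve4563b1 hKL h33 hS31 hBF hmod hGZK hCassels
    (sqrtField (-23)) hK.1 (satisfiesHeegnerHypothesis_curve4563b1 hK.1.1 hK.2) hSD (d := 4681) (by norm_num) hd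
    (sign_mul_jacobiSym_conductorNorm_curve4563b1 (by norm_num) (by norm_num) (by norm_num)) (by norm_num)
    (by norm_num)

/-! ## The four bases additive at `2` -/

/-- **`y² = x³ + 79092 = 972d1^{(13)}`**: elliptic, globally minimal, `ord_{s=1} L = 1 ∧ BSD(·, 2)` BY NAME (seven
facts + the displayed (★)-datum of `(972d1, ℚ(√−23))` incl. the Manin clause; `13 ∈ 𝒩` decided in the kernel).
[cite: KrizLi2019, Thm. 5.1 (2), Thm. 4.3, Def. 4.1, §6 Ex. 6.2] [cite: CreutzMiller2012, Thm. 1.1]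
[cite: BurungaleFlach2024, Thm. 1.1 and Cor. 2] [cite: MilneADT2006, Thm. I.7.3] -/
theorem analyticRank_eq_one_and_bsdp_two_twistModel_thirteen_curve972d1 (hKL : KrizLi2019.thm112_bsdTwo_twist)
    (h33 : KrizLi2019.thm33_rank_twist) (hS31 : bsdTriple_of_analyticRank_le_one_of_conductor_lt)
    (hBF : bsdTriple_of_hasCM_of_L_one_ne_zero) (hmod : hasEntireLFunction_rat)
    (hGZK : rank_eq_analyticRank_of_analyticRank_le_one) (hCassels : bsdRHS_eq_of_isIsogenous)
    (hSD : HasKrizLiStarDatum curve972d1 (sqrtField (-23))) :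
    ∃ (_ : (⟨0, 0, 0, 0, 79092⟩ : WeierstrassCurve ℚ).IsElliptic)
      (_ : (⟨0, 0, 0, 0, 79092⟩ : WeierstrassCurve ℚ).IsGloballyMinimal),
      (⟨0, 0, 0, 0, 79092⟩ : WeierstrassCurve ℚ).analyticRank = 1 ∧ BSDp (⟨0, 0, 0, 0, 79092⟩ : WeierstrassCurve ℚ) 2 := by
  have h := analyticRank_eq_one_and_bsdp_two_twistModel_curve972d1 hKL h33 hS31 hBF hmod hGZK hCassels
    isImaginaryQuadratic_and_discr_sqrtField_neg_twentyThree.1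
    (by rw [isImaginaryQuadratic_and_discr_sqrtField_neg_twentyThree.2]; norm_num)
    (by rw [isImaginaryQuadratic_and_discr_sqrtField_neg_twentyThree.2]; norm_num)
    hSD (d := 13) (a6 := 79092) (by norm_num) inN_thirteen_curve972d1 (by norm_num) (by norm_num)
  simpa using h

/-- **`y² = x³ + 4394 = 1728a1^{(13)}`**: elliptic, globally minimal, `ord_{s=1} L = 1 ∧ BSD(·, 2)` BY NAME (seven
facts + the displayed (★)-datum of `(1728a1, ℚ(√−23))` incl. the Manin clause).
[cite: KrizLi2019, Thm. 5.1 (2), Thm. 4.3, Def. 4.1, §6 Ex. 6.2] [cite: CreutzMiller2012, Thm. 1.1]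
[cite: BurungaleFlach2024, Thm. 1.1 and Cor. 2] [cite: MilneADT2006, Thm. I.7.3] -/
theorem analyticRank_eq_one_and_bsdp_two_twistModel_thirteen_curve1728a1 (hKL : KrizLi2019.thm112_bsdTwo_twist)
    (h33 : KrizLi2019.thm33_rank_twist) (hS31 : bsdTriple_of_analyticRank_le_one_of_conductor_lt)
    (hBF : bsdTriple_of_hasCM_of_L_one_ne_zero) (hmod : hasEntireLFunction_rat)
    (hGZK : rank_eq_analyticRank_of_analyticRank_le_one) (hCassels : bsdRHS_eq_of_isIsogenous)
    (hSD : HasKrizLiStarDatum curve1728a1 (sqrtField (-23))) :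
    ∃ (_ : (⟨0, 0, 0, 0, 4394⟩ : WeierstrassCurve ℚ).IsElliptic)
      (_ : (⟨0, 0, 0, 0, 4394⟩ : WeierstrassCurve ℚ).IsGloballyMinimal),
      (⟨0, 0, 0, 0, 4394⟩ : WeierstrassCurve ℚ).analyticRank = 1 ∧ BSDp (⟨0, 0, 0, 0, 4394⟩ : WeierstrassCurve ℚ) 2 := by
  have h := analyticRank_eq_one_and_bsdp_two_twistModel_curve1728a1 hKL h33 hS31 hBF hmod hGZK hCassels
    isImaginaryQuadratic_and_discr_sqrtField_neg_twentyThree.1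
    (by rw [isImaginaryQuadratic_and_discr_sqrtField_neg_twentyThree.2]; norm_num)
    (by rw [isImaginaryQuadratic_and_discr_sqrtField_neg_twentyThree.2]; norm_num)
    hSD (d := 13) (a6 := 4394) (by norm_num) inN_thirteen_curve1728a1 (by norm_num) (by norm_num)
  simpa using h

/-- **`y² = x³ − 4394 = 1728v1^{(13)}`**: elliptic, globally minimal, `ord_{s=1} L = 1 ∧ BSD(·, 2)` BY NAME (seven
facts + the displayed (★)-datum of `(1728v1, ℚ(√−23))` incl. the Manin clause).
[cite: KrizLi2019, Thm. 5.1 (2), Thm. 4.3, Def. 4.1, §6 Ex. 6.2] [cite: CreutzMiller2012, Thm. 1.1]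
[cite: BurungaleFlach2024, Thm. 1.1 and Cor. 2] [cite: MilneADT2006, Thm. I.7.3] -/
theorem analyticRank_eq_one_and_bsdp_two_twistModel_thirteen_curve1728v1 (hKL : KrizLi2019.thm112_bsdTwo_twist)
    (h33 : KrizLi2019.thm33_rank_twist) (hS31 : bsdTriple_of_analyticRank_le_one_of_conductor_lt)
    (hBF : bsdTriple_of_hasCM_of_L_one_ne_zero) (hmod : hasEntireLFunction_rat)
    (hGZK : rank_eq_analyticRank_of_analyticRank_le_one) (hCassels : bsdRHS_eq_of_isIsogenous)
    (hSD : HasKrizLiStarDatum curve1728v1 (sqrtField (-23))) :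
    ∃ (_ : (⟨0, 0, 0, 0, -4394⟩ : WeierstrassCurve ℚ).IsElliptic)
      (_ : (⟨0, 0, 0, 0, -4394⟩ : WeierstrassCurve ℚ).IsGloballyMinimal),
      (⟨0, 0, 0, 0, -4394⟩ : WeierstrassCurve ℚ).analyticRank = 1 ∧
        BSDp (⟨0, 0, 0, 0, -4394⟩ : WeierstrassCurve ℚ) 2 := by
  have h := analyticRank_eq_one_and_bsdp_two_twistModel_curve1728v1 hKL h33 hS31 hBF hmod hGZK hCassels
    isImaginaryQuadratic_and_discr_sqrtField_neg_twentyThree.1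
    (by rw [isImaginaryQuadratic_and_discr_sqrtField_neg_twentyThree.2]; norm_num)
    (by rw [isImaginaryQuadratic_and_discr_sqrtField_neg_twentyThree.2]; norm_num)
    hSD (d := 13) (a6 := -4394) (by norm_num) inN_thirteen_curve1728v1 (by norm_num) (by norm_num)
  simpa using h

/-- **`y² = x³ + 105456 = 3888s1^{(13)}`**: elliptic, globally minimal (KRAUS at `2`: `Δ = −2¹²·3⁵·13⁶`, `c₄ = 0`),
`ord_{s=1} L = 1 ∧ BSD(·, 2)` BY NAME (seven facts + the displayed (★)-datum of `(3888s1, ℚ(√−23))` incl. the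
Manin clause). [cite: KrizLi2019, Thm. 5.1 (2), Thm. 4.3, Def. 4.1, §6 Ex. 6.2] [cite: CreutzMiller2012, Thm. 1.1]
[cite: BurungaleFlach2024, Thm. 1.1 and Cor. 2] [cite: MilneADT2006, Thm. I.7.3] [cite: Kraus1989, Prop. 2] -/
theorem analyticRank_eq_one_and_bsdp_two_twistModel_thirteen_curve3888s1 (hKL : KrizLi2019.thm112_bsdTwo_twist)
    (h33 : KrizLi2019.thm33_rank_twist) (hS31 : bsdTriple_of_analyticRank_le_one_of_conductor_lt)
    (hBF : bsdTriple_of_hasCM_of_L_one_ne_zero) (hmod : hasEntireLFunction_rat)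
    (hGZK : rank_eq_analyticRank_of_analyticRank_le_one) (hCassels : bsdRHS_eq_of_isIsogenous)
    (hSD : HasKrizLiStarDatum curve3888s1 (sqrtField (-23))) :
    ∃ (_ : (⟨0, 0, 0, 0, 105456⟩ : WeierstrassCurve ℚ).IsElliptic)
      (_ : (⟨0, 0, 0, 0, 105456⟩ : WeierstrassCurve ℚ).IsGloballyMinimal),
      (⟨0, 0, 0, 0, 105456⟩ : WeierstrassCurve ℚ).analyticRank = 1 ∧
        BSDp (⟨0, 0, 0, 0, 105456⟩ : WeierstrassCurve ℚ) 2 := by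
  have h := analyticRank_eq_one_and_bsdp_two_twistModel_curve3888s1 hKL h33 hS31 hBF hmod hGZK hCassels
    isImaginaryQuadratic_and_discr_sqrtField_neg_twentyThree.1
    (by rw [isImaginaryQuadratic_and_discr_sqrtField_neg_twentyThree.2]; norm_num)
    (by rw [isImaginaryQuadratic_and_discr_sqrtField_neg_twentyThree.2]; norm_num)
    hSD (d := 13) (a6 := 105456) (by norm_num) inN_thirteen_curve3888s1 (by norm_num) (by norm_num)
  simpa using h

/-- Why Kraus is needed for the last curve: Silverman's disjuncts FAIL at `2` (`2¹² ∣ Δ`, `2⁴ ∣ c₄ = 0`), decided.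
[cite: SilvermanAEC2009, VII.1 Remark 1.1] -/
theorem silverman_fails_at_two_twistModel_thirteen_curve3888s1 :
    (2 : ℤ) ^ 12 ∣ discOf [0, 0, 0, 0, 105456] ∧ (2 : ℤ) ^ 4 ∣ c4Of [0, 0, 0, 0, 105456] := by
  constructor <;> decide +kernel

end Summit.BirchSwinnertonDyer.Rank1Residual.P2

end
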